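import Literature.Analysis.FluidPDE.DuchonRobertInviscidLimit
import Literature.Analysis.FluidPDE.OnsagerCCFSFlux
import Literature.Analysis.FunctionSpaces.TorusPeriodization
import HarnessLib

/-!
# Duchon–Robert's local energy balance (Prop. 1–2): decomposition along the printed proof

`Literature.Analysis.FluidPDE.DuchonRobert` records as the named fact
`FluidPDE.duchon_robert_defect_exists` the content of Duchon–Robert 2000, Prop. 1 (Navier–Stokes,
p. 250) and Prop. 2 (Euler, p. 251): for a distributional solution `(u, p)` on `T^d × (0,T)` with
`u ∈ L³_{t,x}`, `p ∈ L^{3/2}_{t,x}` (and `u ∈ L²_t H¹_x` in the viscous case) the Duchon–Robert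
fluxes `D_ε(u) = ¼ ∫ ∇φ^ε(ξ)·δu |δu|² dξ` converge in `𝒟'((0,T) × T^d)` to a defect `D(u)`,
independent of the mollifier `φ`, and the local energy balance
`∂ₜ(½|u|²) + div(u(½|u|² + p)) − νΔ½|u|² + ν|∇u|² + D(u) = 0` holds. That fact is hypothesis (P2)
of the accepted reduction `Torus.IsDissipationMeasureOf.hasDuchonRobertDefect_of`
(`DuchonRobertInviscidLimit`) of the target fact `Torus.IsDissipationMeasureOf.hasDuchonRobertDefect`
(Duchon–Robert 2000, Prop. 4).

This file **decomposes (P2) along the printed proof** (proof of Prop. 1, pp. 250–251: regularise,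
`u^ε = φ^ε ∗ u`; multiply the equation for `u` by `u^ε` and the regularised equation by `u`, add;
rewrite the commutator through the cubic identity for `∫ ∇φ^ε(ξ)·δu|δu|² dξ`; let `ε → 0`) into
five named facts, and **proves the assembly** `Torus.duchon_robert_defect_exists_of` together with
all the glue:

* `Torus.integral_kernelFlux_mul_eq` (**named fact**, the cubic identity; pure algebra, Fubini,
  `div u = 0`);
* `Torus.IsDistributionalNSSolutionOn.symmTestField_identity` (**named fact**, the momentum
  equation tested with the symmetric field `Φ = ψ u^ε + (ψu)^ε`, whose time-derivative pairing is
  `∫∫ ⟪u, u^ε⟫ ∂ₜψ` — the weak form of "`(NS)·u^ε + (NS^ε)·u`"; its justification for weak solutions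
  is the time-mollification argument of CCFS 2008, §3.1, as in the tree's
  `Torus.energyBalance_vecConv_holds`, `OnsagerCCFSTestField`);
* `Torus.tendsto_mollified_transport`, `Torus.tendsto_pressure_pairing`,
  `Torus.tendsto_viscous_pairing` (**named facts**, the limits `ε → 0⁺` of the transport, pressure
  and viscous pairings; Evans, App. C.4, Thm. 7 (iv));
* `Torus.four_mul_duchonRobertApprox_eq_kernelFlux` (**proved**): unfolding Duchon–Robert's `ℝ^d`
  integral onto the torus, `4 D_ε(v)(x) = 𝒟_{K_ε}(v)(x)` for `v ∈ L³`, with the torus kernel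
  `K_ε = ∑ₖ φ^ε(· + k)` (`Torus.mollifierKernel`: smooth, even, nonnegative, unit mass) and the
  torus flux `𝒟_K(v)(x) = ∫_{T^d} ⟪∇K(z), δv(x;z)⟫|δv(x;z)|² dz` (`Torus.kernelFlux`);
* `Torus.exists_hasWeakGradient_of_memL2Sobolev` (**proved**): the hypothesis-minimal form of the
  accepted `Torus.IsLerayHopfOn.exists_hasWeakGradient_holds` (spectral weak gradient with
  Parseval for `L²_t H¹_x` fields);
* `Torus.duchon_robert_defect_exists_of` (**proved**): the assembly. The defect functional is the
  local energy flux itself,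
  `D(u)(ψ) = ∫₀ᵀ∫ [½|u|²∂ₜψ + (½|u|² + p)⟪u,∇ψ⟫ + ½ν|u|²Δψ − ν|∇u|²ψ]`, so that
  `Torus.HasLocalEnergyBalance` holds by construction and the content is the convergence
  `∫₀ᵀ∫ D_ε(u)ψ → D(u)(ψ)`: for `ε > 0`, `4∫∫ D_εψ = ∫∫ 𝒟_{K_ε}ψ = A_ε − B_ε + 2E_ε − 2C_ε` with
  `−C_ε = T_ε + νV_ε + P_ε`, and the six limits give `4 D(u)(ψ)` after Fubini splitting;
* `Torus.IsDissipationMeasureOf.hasDuchonRobertDefect_of_steps` (**proved**): the target fact from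
  the pressure fact (A1) `Torus.exists_pressure_of_tendsto_L3` and the five step facts (uniqueness
  of weak gradients, hypothesis (U) of the reduction, is the accepted
  `Torus.HasWeakGradient.unique_holds`).

The arithmetic behind the assembly (all integrals over `(0,T) × T^d`, `K = K_ε`):
`4 D_ε` unfolds to `𝒟_K`; the cubic identity gives
`∫∫𝒟_Kψ = ∫∫⟪(|u|²u)^K,∇ψ⟫ − ∫∫(|u|²)^K⟪u,∇ψ⟫ + 2∫∫⟪u,u^K⟫⟪u,∇ψ⟫ − 2∫∫⟪u,(u·∇)Φ⟫`; the tested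
equation gives `−∫∫⟪u,(u·∇)Φ⟫ = ∫∫⟪u,u^K⟫∂ₜψ + ν∫∫⟪u,ΔΦ⟫ + ∫∫p divΦ`; as `ε → 0⁺` the three
transport terms tend to `∫∫|u|²⟪u,∇ψ⟫`, the time term to `∫∫|u|²∂ₜψ`, the pressure term to
`2∫∫p⟪u,∇ψ⟫` and the viscous term to `∫∫|u|²Δψ − 2∫∫|∇u|²ψ`; summing,
`lim ∫∫D_εψ = ∫∫[½|u|²∂ₜψ + (½|u|²+p)⟪u,∇ψ⟫ + ½ν|u|²Δψ − ν|∇u|²ψ]`. (The signs and the factor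
bookkeeping were checked numerically on an exact two-dimensional Navier–Stokes solution before
the facts were stated.)

## Design notes

* The facts are stated for a general smooth **even** kernel `K` (cubic identity, tested equation)
  resp. for the torus kernels `K_ε` of an arbitrary mollifier `φ` (limits), in every dimension `d`;
  `ε > 0` is not restricted to small values (the periodisation handles kernels wider than the
  fundamental domain). Hypotheses are the joint bounds `∫⁻₍₀,T₎∫⁻ ‖u‖ₑ³ < ∞`,
  `∫⁻₍₀,T₎∫⁻ ‖p‖ₑ^{3/2} < ∞` (as in `DuchonRobertInviscidLimit`); the guarded mixed classes
  `Torus.MemLqLp` of (P2) are converted (`Torus.lintegral_rpow_lt_top_of_memLqLp`).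
* The symmetric field `Φ` replaces the printed asymmetric pairing: for smooth solutions
  `∫∫⟪u, ∂ₜΦ⟫ = ∫∫⟪u,u^K⟫∂ₜψ` exactly (evenness of `K`), which is what makes the time-mollified
  approximants of the discharge computable without a commutator, as in `OnsagerCCFSTestField`.
* In the inviscid case the weak gradient offered is `0` and the viscous limit fact is not invoked.

## Sources

* J. Duchon, R. Robert, *Inertial energy dissipation for weak solutions of incompressible Euler
  and Navier–Stokes equations*, Nonlinearity 13 (2000) 249–255: Prop. 1 (p. 250), its proof
  (pp. 250–251), Prop. 2 (p. 251) — locators as recorded by the tree's `DuchonRobertInviscidLimit`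
  (paywalled; acquisition request on file). [DuchonRobert2000]
* G. L. Eyink, *Local 4/5-law and energy dissipation anomaly in turbulence*, Nonlinearity 16
  (2003) = arXiv:nlin/0208004, §1 (p. 3): restatement of Duchon–Robert's Prop. 2 and Prop. 4.
  [Eyink2003]
* A. Cheskidov, P. Constantin, S. Friedlander, R. Shvydkoy, Nonlinearity 21 (2008) =
  arXiv:0704.0759, §3.1 (mollified solutions as test functions). [CCFS2008]
* L. C. Evans, *Partial Differential Equations*, 2nd ed. (2010), App. C.4 Thm. 7, §5.2.1, §5.9.2.
  [Evans2010]
* E. M. Stein, G. Weiss, *Introduction to Fourier Analysis on Euclidean Spaces* (1971), Ch. VII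
  §2 (periodisation). [SteinWeiss1971]

## Mathlib search

Mathlib (this pin) has group convolution on the compact abelian group `T^d`
(`MeasureTheory.convolution`, used through the tree's `TorusConvolution` / `Torus.vecConv`),
translation invariance of Haar integrability (`MeasureTheory.Integrable.comp_add_left`), support
of derivatives (`support_fderiv_subset`, `HasCompactSupport.fderiv`); no mollifier/defect API
(searched `mollifier`, `periodiz`, `commutator` + `convolution`). Tree: `Torus.periodize` and the
unfolding `Torus.integral_eq_integral_perSum_repr` (`TorusPeriodization`), `Torus.vecConv`
(`OnsagerCCFSFlux`), the glue of `DuchonRobertInviscidLimit` and `DissipationAnomalyProofs`.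
-/

noncomputable section

open MeasureTheory TopologicalSpace Set Function Filter Topology Metric
open scoped ENNReal NNReal Convolution ContDiff InnerProductSpace RealInnerProductSpace

namespace Literature.Analysis.FluidPDE.Torus

variable {d : Type*} [Fintype d] [DecidableEq d]

/-! ## The torus kernel of a Euclidean mollifier -/

/-- The **torus kernel** `K_ε = ∑_{k ∈ ℤ^d} φ^ε(· + k)` of a Euclidean mollifier `φ` at scale
`ε`: the periodisation onto `T^d` (`Torus.periodize`, Stein–Weiss Ch. VII §2) of the rescaled
mollifier `φ^ε = ε^{-d} φ(·/ε)` (`FluidPDE.mollifierScale`; Duchon–Robert 2000, before Prop. 1: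
"`φ` any infinitely differentiable function with compact support on `ℝ³`, even, non-negative with
integral `1`, and `φ^ε(ξ) = ε⁻³ φ(ξ/ε)`", the convolution `u^ε = φ^ε ∗ u` of a periodic field
being the torus convolution with this kernel). Meaningful for `ε > 0`. [cite: DuchonRobert2000, Prop. 1 p. 250] -/
def mollifierKernel (φ : EuclideanSpace ℝ d → ℝ) (ε : ℝ) : UnitAddTorus d → ℝ :=
  FunctionSpaces.Torus.periodize (FluidPDE.mollifierScale ε φ)

/-- Unfolding `mollifierKernel`. [folklore] -/
theorem mollifierKernel_apply (φ : EuclideanSpace ℝ d → ℝ) (ε : ℝ) (z : UnitAddTorus d) :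
    mollifierKernel φ ε z =
      FunctionSpaces.Torus.perSum (FluidPDE.mollifierScale ε φ) (FunctionSpaces.Torus.repr z) :=
  rfl

/-- A compactly supported function on `ℝ^d` is (topologically) supported in some closed ball.
[folklore] -/
theorem _root_.HasCompactSupport.exists_tsupport_subset_closedBall {E F : Type*}
    [SeminormedAddCommGroup E] [Zero F] [TopologicalSpace F] {f : E → F}
    (hf : HasCompactSupport f) : ∃ R : ℝ, tsupport f ⊆ closedBall 0 R :=
  hf.isCompact.isBounded.subset_closedBall 0

omit [DecidableEq d] in
/-- The rescaled mollifier `φ^ε` of a mollifier is smooth and supported in a closed ball, for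
`ε > 0` (`FluidPDE.IsMollifier.mollifierScale`). [folklore] -/
theorem exists_tsupport_mollifierScale_subset {φ : EuclideanSpace ℝ d → ℝ}
    (hφ : FluidPDE.IsMollifier φ) {ε : ℝ} (hε : 0 < ε) :
    ContDiff ℝ ∞ (FluidPDE.mollifierScale ε φ) ∧
      ∃ R : ℝ, tsupport (FluidPDE.mollifierScale ε φ) ⊆ closedBall 0 R :=
  ⟨(hφ.mollifierScale hε).1, (hφ.mollifierScale hε).2.1.exists_tsupport_subset_closedBall⟩

/-- The torus kernel of a mollifier is smooth for `ε > 0` (`Torus.isSmooth_periodize`). [folklore] -/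
theorem isSmooth_mollifierKernel {φ : EuclideanSpace ℝ d → ℝ} (hφ : FluidPDE.IsMollifier φ)
    {ε : ℝ} (hε : 0 < ε) : FunctionSpaces.Torus.IsSmooth (mollifierKernel φ ε) := by
  obtain ⟨hs, R, hR⟩ := exists_tsupport_mollifierScale_subset hφ hε
  exact FunctionSpaces.Torus.isSmooth_periodize hs hR

/-- The lattice sum of an even function is even: `∑ₖ g(-y + k) = ∑ₖ g(y + k)` (re-index
`k ↦ -k`). [folklore] -/
theorem perSum_neg_of_even {g : EuclideanSpace ℝ d → ℝ} (hg : ∀ ξ, g (-ξ) = g ξ)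
    (y : EuclideanSpace ℝ d) :
    FunctionSpaces.Torus.perSum g (-y) = FunctionSpaces.Torus.perSum g y := by
  unfold FunctionSpaces.Torus.perSum
  rw [← (Equiv.neg (d → ℤ)).tsum_eq (fun k => g (-y + FunctionSpaces.Torus.latticeVec k))]
  refine tsum_congr fun k => ?_
  rw [Equiv.neg_apply, FunctionSpaces.Torus.latticeVec_neg, ← neg_add, hg]

/-- The torus kernel of a mollifier is **even**, `K_ε(-z) = K_ε(z)` (the mollifier is even). [folklore] -/
theorem mollifierKernel_neg {φ : EuclideanSpace ℝ d → ℝ} (hφ : FluidPDE.IsMollifier φ) (ε : ℝ)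
    (z : UnitAddTorus d) : mollifierKernel φ ε (-z) = mollifierKernel φ ε z := by
  have hev : ∀ ξ, FluidPDE.mollifierScale ε φ (-ξ) = FluidPDE.mollifierScale ε φ ξ := fun ξ => by
    rw [FluidPDE.mollifierScale_apply, FluidPDE.mollifierScale_apply, smul_neg, hφ.2.2.1]
  rw [mollifierKernel_apply, mollifierKernel_apply]
  have h1 : FunctionSpaces.Torus.repr (-z) =
      FunctionSpaces.Torus.repr (FunctionSpaces.Torus.proj (-FunctionSpaces.Torus.repr z)) := by
    rw [FunctionSpaces.Torus.proj_neg, FunctionSpaces.Torus.proj_repr]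
  rw [h1, FunctionSpaces.Torus.perSum_repr_proj, perSum_neg_of_even hev]

/-- The torus kernel of a mollifier has **unit mass** for `ε > 0`: `∫_{T^d} K_ε = ∫_{ℝ^d} φ^ε = 1`
(unfolding `Torus.integral_eq_integral_perSum_repr` and `FluidPDE.integral_mollifierScale`). [folklore] -/
theorem integral_mollifierKernel {φ : EuclideanSpace ℝ d → ℝ} (hφ : FluidPDE.IsMollifier φ)
    {ε : ℝ} (hε : 0 < ε) : ∫ z, mollifierKernel φ ε z = 1 := by
  obtain ⟨hs, R, hR⟩ := exists_tsupport_mollifierScale_subset hφ hε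
  have hi : Integrable (FluidPDE.mollifierScale ε φ) volume :=
    hs.continuous.integrable_of_hasCompactSupport (hφ.mollifierScale hε).2.1
  simp_rw [mollifierKernel_apply]
  rw [← FunctionSpaces.Torus.integral_eq_integral_perSum_repr hi ((subset_tsupport _).trans hR),
    FluidPDE.integral_mollifierScale hφ hε]

/-- The torus kernel of a mollifier is nonnegative for `ε ≥ 0`. [folklore] -/
theorem mollifierKernel_nonneg {φ : EuclideanSpace ℝ d → ℝ} (hφ : FluidPDE.IsMollifier φ)
    {ε : ℝ} (hε : 0 ≤ ε) (z : UnitAddTorus d) : 0 ≤ mollifierKernel φ ε z :=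
  tsum_nonneg fun _ => mul_nonneg (inv_nonneg.2 (pow_nonneg hε _)) (hφ.2.2.2.1 _)


/-! ## The Duchon–Robert flux through a torus kernel -/

/-- The **Duchon–Robert flux through a torus kernel** `K` of a velocity slice `v : T^d → ℝ^d`:
`𝒟_K(v)(x) = ∫_{T^d} ⟪∇K(z), δv(x;z)⟫ |δv(x;z)|² dz`, `δv(x;z) = v(x + z) - v(x)` — the torus form
of Duchon–Robert's `4 D_ε(u)(x) = ∫_{ℝ^d} ∇φ^ε(ξ)·δu (δu)² dξ` (Duchon–Robert 2000, Prop. 1, the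
definition of `D_ε(u)`; `four_mul_duchonRobertApprox_eq_kernelFlux` below identifies the two for
`K = K_ε`, the torus kernel of `φ`). Bochner integral in `z` (junk `0` off integrability; for
`v ∈ L³` and smooth `K` the integrand is integrable at every `x`). [cite: DuchonRobert2000, Prop. 1 p. 250] -/
def kernelFlux (K : UnitAddTorus d → ℝ) (v : UnitAddTorus d → EuclideanSpace ℝ d)
    (x : UnitAddTorus d) : ℝ :=
  ∫ z, ⟪FunctionSpaces.Torus.gradient K z, v (x + z) - v x⟫ * ‖v (x + z) - v x‖ ^ 2

omit [DecidableEq d] in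
/-- Unfolding `kernelFlux`. [folklore] -/
theorem kernelFlux_apply (K : UnitAddTorus d → ℝ) (v : UnitAddTorus d → EuclideanSpace ℝ d)
    (x : UnitAddTorus d) :
    kernelFlux K v x =
      ∫ z, ⟪FunctionSpaces.Torus.gradient K z, v (x + z) - v x⟫ * ‖v (x + z) - v x‖ ^ 2 :=
  rfl

omit [DecidableEq d] in
/-- The flux of the zero field vanishes. [folklore] -/
@[simp]
theorem kernelFlux_zero (K : UnitAddTorus d → ℝ) (x : UnitAddTorus d) :
    kernelFlux K (0 : UnitAddTorus d → EuclideanSpace ℝ d) x = 0 := by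
  simp [kernelFlux]

/-- **The symmetric Duchon–Robert test field** built from a kernel `K`, a scalar cut-off `χ` and
a velocity slice `v`: `Φ = χ · (v ⋆ K) + (χ v) ⋆ K` (componentwise torus convolutions,
`Torus.vecConv`). Testing the momentum equation with `Φ` is the symmetric (hence time-mollifiable)
form of Duchon–Robert's step "multiply the equation for `u` by `u^ε`, the regularised equation by
`u`, and add" (Duchon–Robert 2000, proof of Prop. 1, p. 250): for smooth solutions
`∫∫ ⟪u, ∂ₜΦ⟫ = ∫∫ ⟪u, u^ε⟫ ∂ₜχ`. [cite: DuchonRobert2000, proof of Prop. 1 p. 250] -/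
def symmTestField (K : UnitAddTorus d → ℝ) (χ : UnitAddTorus d → ℝ)
    (v : UnitAddTorus d → EuclideanSpace ℝ d) : UnitAddTorus d → EuclideanSpace ℝ d :=
  fun x => χ x • vecConv v K x + vecConv (fun y => χ y • v y) K x

omit [DecidableEq d] in
/-- Unfolding `symmTestField`. [folklore] -/
theorem symmTestField_apply (K : UnitAddTorus d → ℝ) (χ : UnitAddTorus d → ℝ)
    (v : UnitAddTorus d → EuclideanSpace ℝ d) (x : UnitAddTorus d) :
    symmTestField K χ v x = χ x • vecConv v K x + vecConv (fun y => χ y • v y) K x :=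
  rfl

omit [DecidableEq d] in
/-- The symmetric test field of the zero velocity vanishes. [folklore] -/
@[simp]
theorem symmTestField_zero (K : UnitAddTorus d → ℝ) (χ : UnitAddTorus d → ℝ) :
    symmTestField K χ (0 : UnitAddTorus d → EuclideanSpace ℝ d) = 0 := by
  funext x
  have h0 : (fun y => χ y • (0 : UnitAddTorus d → EuclideanSpace ℝ d) y) = 0 := by
    funext y; simp
  rw [symmTestField_apply, h0, vecConv_zero]
  simp

/-! ## Unfolding the Duchon–Robert flux onto the torus -/

section Unfold

variable {φ : EuclideanSpace ℝ d → ℝ} {ε : ℝ} {v : UnitAddTorus d → EuclideanSpace ℝ d}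

omit [DecidableEq d] in
/-- The gradient of a compactly supported `C¹` function is continuous, compactly supported and
bounded, and vanishes off the topological support. [folklore] -/
theorem gradient_aux {θ : EuclideanSpace ℝ d → ℝ} (hs : ContDiff ℝ 1 θ) (hc : HasCompactSupport θ) :
    Continuous (gradient θ) ∧ support (gradient θ) ⊆ tsupport θ ∧ ∃ M : ℝ, ∀ ξ, ‖gradient θ ξ‖ ≤ M := by
  have hcont : Continuous (gradient θ) :=
    (InnerProductSpace.toDual ℝ (EuclideanSpace ℝ d)).symm.continuous.comp (hs.continuous_fderiv one_ne_zero)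
  have hsupp : support (gradient θ) ⊆ tsupport θ := fun ξ hξ =>
    support_fderiv_subset ℝ (fun h0 => hξ (by simp [gradient, h0]))
  have hcs : HasCompactSupport (gradient θ) := by
    refine (hc.fderiv (𝕜 := ℝ)).comp_left (g := (InnerProductSpace.toDual ℝ (EuclideanSpace ℝ d)).symm) ?_
    exact map_zero _
  exact ⟨hcont, hsupp, hcs.exists_bound_of_continuous hcont⟩

/-- **Unfolding the Duchon–Robert flux onto the torus** (Stein–Weiss Ch. VII §2, Thm. 2.4 applied
to Duchon–Robert's `D_ε`): for a mollifier `φ`, `ε > 0` and `v ∈ L³(T^d; ℝ^d)`, at every point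
`4 D_ε(v)(x) = ∫_{ℝ^d} ⟪∇φ^ε(ξ), δv(x;ξ)⟫|δv(x;ξ)|² dξ = ∫_{T^d} ⟪∇K_ε(z), δv(x;z)⟫|δv(x;z)|² dz = 𝒟_{K_ε}(v)(x)`
with the torus kernel `K_ε = mollifierKernel φ ε`: the Euclidean integrand is integrable with
bounded support, its lattice sum at `z` collects `∑ₖ ∇φ^ε(repr z + k) = ∇K_ε(z)`
(`Torus.gradient_periodize'`) against the `k`-independent increment
`v(x + proj(repr z + k)) - v(x) = v(x + z) - v(x)`. [folklore] -/
theorem four_mul_duchonRobertApprox_eq_kernelFlux (hφ : FluidPDE.IsMollifier φ) (hε : 0 < ε)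
    (hv : MemLp v 3 volume) (x : UnitAddTorus d) :
    4 * duchonRobertApprox φ ε v x = kernelFlux (mollifierKernel φ ε) v x := by
  obtain ⟨hs, R, hR⟩ := exists_tsupport_mollifierScale_subset hφ hε
  obtain ⟨hcont, hsupp, M, hM⟩ := gradient_aux (hs.of_le (by simp)) (hφ.mollifierScale hε).2.1
  set φε := FluidPDE.mollifierScale ε φ with hφε
  -- the Euclidean integrand and its support
  set g : EuclideanSpace ℝ d → ℝ := fun ξ =>
    ⟪gradient φε ξ, increment v ξ x⟫ * ‖increment v ξ x‖ ^ 2 with hg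
  have hsuppR : support (gradient φε) ⊆ closedBall 0 R := hsupp.trans hR
  have hg_supp : support g ⊆ closedBall 0 R := by
    refine fun ξ hξ => hsuppR fun h0 => hξ ?_
    show ⟪gradient φε ξ, increment v ξ x⟫ * ‖increment v ξ x‖ ^ 2 = 0
    rw [h0, inner_zero_left, zero_mul]
  -- measurability and integrability of the increment on `ℝ^d`
  have hv3 : Integrable (fun y => ‖v y‖ ^ 3) volume := by
    have h := hv.integrable_norm_rpow three_ne_zero ENNReal.ofNat_ne_top
    refine h.congr (ae_of_all _ fun y => ?_)
    rw [ENNReal.toReal_ofNat]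
    exact Real.rpow_natCast _ 3
  have hL : Integrable (fun y => ‖v (x + y)‖ ^ 3) volume := hv3.comp_add_left x
  have hvx : Integrable (fun y => v (x + y)) volume :=
    (hv.integrable (by norm_num)).comp_add_left x
  have hδm : AEStronglyMeasurable (fun ξ : EuclideanSpace ℝ d => increment v ξ x) volume :=
    (FunctionSpaces.Torus.locallyIntegrable_lift hvx).aestronglyMeasurable.sub
      aestronglyMeasurable_const
  have hgm : AEStronglyMeasurable g volume :=
    (hcont.aestronglyMeasurable.inner hδm).mul ((hδm.norm.pow 2))
  have hg_int : Integrable g volume := by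
    rw [← integrableOn_iff_integrable_of_support_subset hg_supp]
    -- on the ball: `|g| ≤ M |δv|³ ≤ 4M (|v(x + ξ)|³ + |v x|³)`
    have hB : IntegrableOn (fun ξ : EuclideanSpace ℝ d =>
        4 * M * (‖v (x + FunctionSpaces.Torus.proj ξ)‖ ^ 3 + ‖v x‖ ^ 3)) (closedBall 0 R) volume := by
      refine Integrable.const_mul (Integrable.add ?_ ?_) _
      · exact FunctionSpaces.Torus.integrableOn_lift_of_subset_closedBall hL subset_rfl
      · exact integrableOn_const (measure_closedBall_lt_top.ne)
    refine hB.mono' hgm.restrict (ae_of_all _ fun ξ => ?_)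
    have hM0 : 0 ≤ M := (norm_nonneg _).trans (hM 0)
    have h3 := norm_sub_pow_three_le (v (x + FunctionSpaces.Torus.proj ξ)) (v x)
    rw [hg, norm_mul, norm_pow, norm_norm]
    calc ‖⟪gradient φε ξ, increment v ξ x⟫‖ * ‖increment v ξ x‖ ^ 2
        ≤ (M * ‖increment v ξ x‖) * ‖increment v ξ x‖ ^ 2 := by
          gcongr
          exact (norm_inner_le_norm _ _).trans (mul_le_mul_of_nonneg_right (hM ξ) (norm_nonneg _))
      _ = M * ‖increment v ξ x‖ ^ 3 := by ring
      _ ≤ M * (4 * (‖v (x + FunctionSpaces.Torus.proj ξ)‖ ^ 3 + ‖v x‖ ^ 3)) :=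
          mul_le_mul_of_nonneg_left h3 hM0
      _ = 4 * M * (‖v (x + FunctionSpaces.Torus.proj ξ)‖ ^ 3 + ‖v x‖ ^ 3) := by ring
  -- unfold both sides
  rw [duchonRobertApprox, ← mul_assoc, mul_inv_cancel₀ (four_ne_zero), one_mul,
    show (∫ ξ, ⟪gradient φε ξ, increment v ξ x⟫ * ‖increment v ξ x‖ ^ 2) = ∫ ξ, g ξ from rfl,
    FunctionSpaces.Torus.integral_eq_integral_perSum_repr hg_int hg_supp, kernelFlux]
  refine integral_congr_ae (ae_of_all _ fun z => ?_)
  -- pointwise: the lattice sum collects the gradients of `φ^ε` into `∇K_ε`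
  have hz : ‖FunctionSpaces.Torus.repr z‖ ≤ Fintype.card d :=
    FunctionSpaces.Torus.norm_le_card_of_mem_unitCube (FunctionSpaces.Torus.repr_mem_unitCube z)
  obtain ⟨n, hn⟩ := exists_nat_ge (R + Fintype.card d)
  dsimp only
  rw [FunctionSpaces.Torus.perSum_eq_sum hg_supp hz hn, mollifierKernel,
    FunctionSpaces.Torus.gradient_periodize' (hs.of_le (by simp)) hR,
    FunctionSpaces.Torus.perSum_eq_sum hsuppR hz hn, sum_inner, Finset.sum_mul]
  refine Finset.sum_congr rfl fun k _ => ?_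
  simp only [hg, increment, FunctionSpaces.Torus.proj_add_latticeVec, FunctionSpaces.Torus.proj_repr]

end Unfold

/-! ## The printed steps of Duchon–Robert's proof, as named facts -/

section Facts

/-- **Duchon–Robert's cubic identity** (Duchon–Robert 2000, proof of Prop. 1, pp. 250–251: the
computation turning `∫ ∇φ^ε(ξ)·δu (δu)² dξ` into mollified transport terms plus the commutator
term `E^ε` of "(NS)·u^ε + (NS^ε)·u", using only `div u = 0`). Transcription on `T^d × (0,T)`, for
a jointly measurable `u ∈ L³((0,T) × T^d)` that is weakly divergence free for a.e. `t`, a smooth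
**even** kernel `K` and a test function `ψ` supported in `(0,T)`; with `u^K = u ⋆ K`
(`Torus.vecConv`, slice-wise), `Φ = ψ u^K + (ψ u) ⋆ K` (`Torus.symmTestField`) and the torus flux
`𝒟_K` (`Torus.kernelFlux`):
`∫₀ᵀ∫ 𝒟_K(u) ψ = ∫₀ᵀ∫ ⟪(|u|²u) ⋆ K, ∇ψ⟫ − ∫₀ᵀ∫ (|u|² ⋆ K) ⟪u, ∇ψ⟫ + 2 ∫₀ᵀ∫ ⟪u, u^K⟫ ⟪u, ∇ψ⟫ − 2 ∫₀ᵀ∫ ⟪u, (u·∇)Φ⟫`.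
(Expanding `(δu)_j |δu|²` and integrating each monomial against `∂_jK`: the terms
`−div((u|u|²) ⋆ K)`, `2 uᵢ ∂ⱼ((uᵢuⱼ) ⋆ K)`, `u·∇(|u|² ⋆ K)`, `−2 uᵢuⱼ ∂ⱼuᵢ^K`, the others vanishing
by `div u^K = 0` and `∫ ∇K = 0`; then integration by parts onto `ψ`, evenness of `K`
(adjointness of `⋆ K`, oddness of `∂ⱼK`) and weak divergence-freeness of the slices; all four
right-hand integrands are integrable for `u ∈ L³_{t,x}`.) [cite: DuchonRobert2000, proof of Prop. 1 pp. 250–251] -/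
def integral_kernelFlux_mul_eq : Prop :=
  ∀ {T : ℝ} {u : ℝ → UnitAddTorus d → EuclideanSpace ℝ d}
    (_hmeas : AEStronglyMeasurable (FunctionSpaces.Torus.stLift u) (volume.restrict (Ioo 0 T ×ˢ univ)))
    (_hu3 : ∫⁻ t in Ioo 0 T, ∫⁻ x, ‖u t x‖ₑ ^ 3 < ⊤)
    (_hdiv : ∀ᵐ t ∂(volume.restrict (Ioo 0 T)), FunctionSpaces.Torus.IsWeaklyDivFree (u t))
    {K : UnitAddTorus d → ℝ} (_hK : FunctionSpaces.Torus.IsSmooth K) (_hKev : ∀ z, K (-z) = K z)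
    {ψ : ℝ → UnitAddTorus d → ℝ} (_hψ : FunctionSpaces.Torus.IsSpaceTimeTestIoo T ψ),
    ∫ t in Ioo 0 T, ∫ x, kernelFlux K (u t) x * ψ t x =
      (∫ t in Ioo 0 T, ∫ x,
          ⟪vecConv (fun y => ‖u t y‖ ^ 2 • u t y) K x, FunctionSpaces.Torus.gradient (ψ t) x⟫) -
        (∫ t in Ioo 0 T, ∫ x,
          ((fun y => ‖u t y‖ ^ 2) ⋆ K) x * ⟪u t x, FunctionSpaces.Torus.gradient (ψ t) x⟫) +
        2 * (∫ t in Ioo 0 T, ∫ x,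
          ⟪u t x, vecConv (u t) K x⟫ * ⟪u t x, FunctionSpaces.Torus.gradient (ψ t) x⟫) -
        2 * ∫ t in Ioo 0 T, ∫ x,
          ⟪u t x, FunctionSpaces.Torus.convect (u t) (symmTestField K (ψ t) (u t)) x⟫

/-- **The momentum equation tested with the symmetric mollified field** (Duchon–Robert 2000,
proof of Prop. 1, p. 250: the regularised equation `∂ₜu^ε + ∂ⱼ(uⱼu)^ε + ∇p^ε = νΔu^ε` is
multiplied by `u`, the equation for `u` by `u^ε`, and the two are added, producing
`∂ₜ(u·u^ε)`; the "straightforward" justification of this step for a weak solution is the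
time-mollification argument of Cheskidov–Constantin–Friedlander–Shvydkoy 2008, §3.1, last
paragraph, as formalised for the tree's `Torus.energyBalance_vecConv_holds`). Transcription: for a
distributional (pressure-explicit, unforced) Navier–Stokes/Euler solution `(u, p)` on
`T^d × (0,T)` (`Torus.IsDistributionalNSSolutionOn T ν 0 u p`) with `u ∈ L³_{t,x}`,
`p ∈ L^{3/2}_{t,x}`, a smooth even kernel `K` and a scalar test function `ψ` supported in `(0,T)`,
the weak formulation holds for the field `Φ = ψ u^K + (ψ u) ⋆ K` (`Torus.symmTestField`, smooth in
space, not in time), its time-derivative pairing taking the value `∫₀ᵀ∫ ⟪u, u^K⟫ ∂ₜψ`: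
`∫₀ᵀ∫ ⟪u, u^K⟫ ∂ₜψ + ∫₀ᵀ∫ ⟪u, (u·∇)Φ⟫ + ν ∫₀ᵀ∫ ⟪u, ΔΦ⟫ + ∫₀ᵀ∫ p div Φ = 0`. [cite: DuchonRobert2000, proof of Prop. 1 p. 250] -/
def IsDistributionalNSSolutionOn.symmTestField_identity : Prop :=
  ∀ {T ν : ℝ} {u : ℝ → UnitAddTorus d → EuclideanSpace ℝ d} {p : ℝ → UnitAddTorus d → ℝ}
    (_hsol : IsDistributionalNSSolutionOn T ν 0 u p)
    (_hu3 : ∫⁻ t in Ioo 0 T, ∫⁻ x, ‖u t x‖ₑ ^ 3 < ⊤)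
    (_hp : ∫⁻ t in Ioo 0 T, ∫⁻ x, ‖p t x‖ₑ ^ (3 / 2 : ℝ) < ⊤)
    {K : UnitAddTorus d → ℝ} (_hK : FunctionSpaces.Torus.IsSmooth K) (_hKev : ∀ z, K (-z) = K z)
    {ψ : ℝ → UnitAddTorus d → ℝ} (_hψ : FunctionSpaces.Torus.IsSpaceTimeTestIoo T ψ),
    (∫ t in Ioo 0 T, ∫ x, ⟪u t x, vecConv (u t) K x⟫ * FunctionSpaces.Torus.timeDeriv ψ t x) +
      (∫ t in Ioo 0 T, ∫ x,
        ⟪u t x, FunctionSpaces.Torus.convect (u t) (symmTestField K (ψ t) (u t)) x⟫) +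
      ν * (∫ t in Ioo 0 T, ∫ x,
        ⟪u t x, FunctionSpaces.Torus.laplacian (symmTestField K (ψ t) (u t)) x⟫) +
      (∫ t in Ioo 0 T, ∫ x,
        p t x * FunctionSpaces.Torus.divergence (symmTestField K (ψ t) (u t)) x) = 0

/-- **The mollified transport terms converge** (Duchon–Robert 2000, proof of Prop. 1, p. 251:
"letting `ε` go to `0`", the cubic terms; Evans, *PDE*, App. C.4, Thm. 7 (iv): `f ⋆ φ_ε → f` in
`L^q`, `1 ≤ q < ∞`). Transcription: for a jointly measurable `u ∈ L³((0,T) × T^d)`, a mollifier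
`φ` with torus kernels `K_ε` (`Torus.mollifierKernel`) and a test function `ψ` supported in
`(0,T)`, as `ε → 0⁺` each of
`∫₀ᵀ∫ ⟪(|u|²u) ⋆ K_ε, ∇ψ⟫`, `∫₀ᵀ∫ (|u|² ⋆ K_ε) ⟪u, ∇ψ⟫`, `∫₀ᵀ∫ ⟪u, u ⋆ K_ε⟫ ⟪u, ∇ψ⟫`
tends to `∫₀ᵀ∫ |u|² ⟪u, ∇ψ⟫`, and `∫₀ᵀ∫ ⟪u, u ⋆ K_ε⟫ ∂ₜψ` tends to `∫₀ᵀ∫ |u|² ∂ₜψ`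
(`(|u|²u) ⋆ K_ε → |u|²u` in `L¹`, `|u|² ⋆ K_ε → |u|²` in `L^{3/2}`, `u ⋆ K_ε → u` in `L³`, paired
with `∇ψ ∈ L^∞`, `⟪u,∇ψ⟫ ∈ L³`, `u ⟪u,∇ψ⟫, u ∂ₜψ ∈ L^{3/2}`). [cite: Evans2010, App. C.4 Thm. 7 (iv)] -/
def tendsto_mollified_transport : Prop :=
  ∀ {T : ℝ} {u : ℝ → UnitAddTorus d → EuclideanSpace ℝ d}
    (_hmeas : AEStronglyMeasurable (FunctionSpaces.Torus.stLift u) (volume.restrict (Ioo 0 T ×ˢ univ)))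
    (_hu3 : ∫⁻ t in Ioo 0 T, ∫⁻ x, ‖u t x‖ₑ ^ 3 < ⊤)
    {φ : EuclideanSpace ℝ d → ℝ} (_hφ : FluidPDE.IsMollifier φ)
    {ψ : ℝ → UnitAddTorus d → ℝ} (_hψ : FunctionSpaces.Torus.IsSpaceTimeTestIoo T ψ),
    Tendsto (fun ε => ∫ t in Ioo 0 T, ∫ x,
        ⟪vecConv (fun y => ‖u t y‖ ^ 2 • u t y) (mollifierKernel φ ε) x,
          FunctionSpaces.Torus.gradient (ψ t) x⟫) (𝓝[>] 0)
      (𝓝 (∫ t in Ioo 0 T, ∫ x, ‖u t x‖ ^ 2 * ⟪u t x, FunctionSpaces.Torus.gradient (ψ t) x⟫)) ∧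
    Tendsto (fun ε => ∫ t in Ioo 0 T, ∫ x,
        ((fun y => ‖u t y‖ ^ 2) ⋆ mollifierKernel φ ε) x *
          ⟪u t x, FunctionSpaces.Torus.gradient (ψ t) x⟫) (𝓝[>] 0)
      (𝓝 (∫ t in Ioo 0 T, ∫ x, ‖u t x‖ ^ 2 * ⟪u t x, FunctionSpaces.Torus.gradient (ψ t) x⟫)) ∧
    Tendsto (fun ε => ∫ t in Ioo 0 T, ∫ x,
        ⟪u t x, vecConv (u t) (mollifierKernel φ ε) x⟫ *
          ⟪u t x, FunctionSpaces.Torus.gradient (ψ t) x⟫) (𝓝[>] 0)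
      (𝓝 (∫ t in Ioo 0 T, ∫ x, ‖u t x‖ ^ 2 * ⟪u t x, FunctionSpaces.Torus.gradient (ψ t) x⟫)) ∧
    Tendsto (fun ε => ∫ t in Ioo 0 T, ∫ x,
        ⟪u t x, vecConv (u t) (mollifierKernel φ ε) x⟫ * FunctionSpaces.Torus.timeDeriv ψ t x)
      (𝓝[>] 0)
      (𝓝 (∫ t in Ioo 0 T, ∫ x, ‖u t x‖ ^ 2 * FunctionSpaces.Torus.timeDeriv ψ t x))

/-- **The pressure pairing converges** (Duchon–Robert 2000, proof of Prop. 1, p. 251: the term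
`div(½(u p^ε + u^ε p)) → div(u p)`; Evans, App. C.4, Thm. 7 (iv)). Transcription: for jointly
measurable `u ∈ L³((0,T) × T^d)` (weakly divergence free for a.e. `t`) and
`p ∈ L^{3/2}((0,T) × T^d)`, a mollifier `φ` and a test function `ψ` supported in `(0,T)`, the
pressure pairing of the symmetric field `Φ_ε = ψ u^{K_ε} + (ψ u) ⋆ K_ε`, whose divergence is
`⟪u ⋆ K_ε, ∇ψ⟫ + ⟪u, ∇ψ⟫ ⋆ K_ε`, satisfies
`∫₀ᵀ∫ p div Φ_ε → 2 ∫₀ᵀ∫ p ⟪u, ∇ψ⟫` as `ε → 0⁺`. [cite: Evans2010, App. C.4 Thm. 7 (iv)] -/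
def tendsto_pressure_pairing : Prop :=
  ∀ {T : ℝ} {u : ℝ → UnitAddTorus d → EuclideanSpace ℝ d} {p : ℝ → UnitAddTorus d → ℝ}
    (_hmeas : AEStronglyMeasurable (FunctionSpaces.Torus.stLift u) (volume.restrict (Ioo 0 T ×ˢ univ)))
    (_hu3 : ∫⁻ t in Ioo 0 T, ∫⁻ x, ‖u t x‖ₑ ^ 3 < ⊤)
    (_hdiv : ∀ᵐ t ∂(volume.restrict (Ioo 0 T)), FunctionSpaces.Torus.IsWeaklyDivFree (u t))
    (_hpmeas : AEStronglyMeasurable (FunctionSpaces.Torus.stLift p) (volume.restrict (Ioo 0 T ×ˢ univ)))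
    (_hp : ∫⁻ t in Ioo 0 T, ∫⁻ x, ‖p t x‖ₑ ^ (3 / 2 : ℝ) < ⊤)
    {φ : EuclideanSpace ℝ d → ℝ} (_hφ : FluidPDE.IsMollifier φ)
    {ψ : ℝ → UnitAddTorus d → ℝ} (_hψ : FunctionSpaces.Torus.IsSpaceTimeTestIoo T ψ),
    Tendsto (fun ε => ∫ t in Ioo 0 T, ∫ x,
        p t x * FunctionSpaces.Torus.divergence (symmTestField (mollifierKernel φ ε) (ψ t) (u t)) x)
      (𝓝[>] 0)
      (𝓝 (2 * ∫ t in Ioo 0 T, ∫ x, p t x * ⟪u t x, FunctionSpaces.Torus.gradient (ψ t) x⟫))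

/-- **The viscous pairing converges** (Duchon–Robert 2000, proof of Prop. 1, p. 251: the terms
`νΔ(u·u^ε) → νΔ|u|²` and `ν ∇u:∇u^ε → ν|∇u|²` for `u ∈ L²(0,T; H¹)`; Evans, App. C.4, Thm. 7
(iv) and §5.2.1). Transcription: for jointly measurable `u ∈ L³((0,T) × T^d)` with a jointly
measurable, slice-wise integrable weak spatial gradient `G ∈ L²((0,T) × T^d)`
(`Torus.HasWeakGradient`, dissipation density `Torus.weakGradNormSq G = |G|²`), a mollifier `φ`
and a test function `ψ` supported in `(0,T)`, the Laplacian pairing of the symmetric field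
`Φ_ε = ψ u^{K_ε} + (ψ u) ⋆ K_ε` — which equals `∫₀ᵀ∫ ⟪u, u^{K_ε}⟫ Δψ − 2 ∫₀ᵀ∫ ψ G : ∇u^{K_ε}`
after moving one derivative onto `u`, with `∇u^{K_ε} = G ⋆ K_ε` — satisfies
`∫₀ᵀ∫ ⟪u, ΔΦ_ε⟫ → ∫₀ᵀ∫ |u|² Δψ − 2 ∫₀ᵀ∫ |G|² ψ` as `ε → 0⁺`. [cite: Evans2010, App. C.4 Thm. 7 (iv)] -/
def tendsto_viscous_pairing : Prop :=
  ∀ {T : ℝ} {u : ℝ → UnitAddTorus d → EuclideanSpace ℝ d}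
    (_hmeas : AEStronglyMeasurable (FunctionSpaces.Torus.stLift u) (volume.restrict (Ioo 0 T ×ˢ univ)))
    (_hu3 : ∫⁻ t in Ioo 0 T, ∫⁻ x, ‖u t x‖ₑ ^ 3 < ⊤)
    {G : ℝ → UnitAddTorus d → EuclideanSpace ℝ d →L[ℝ] EuclideanSpace ℝ d}
    (_hGmeas : AEStronglyMeasurable (uncurry G) ((volume.restrict (Ioo 0 T)).prod volume))
    (_hG : ∀ᵐ t ∂(volume.restrict (Ioo 0 T)), HasWeakGradient (u t) (G t) ∧ Integrable (G t) volume)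
    (_hG2 : ∫⁻ t in Ioo 0 T, ∫⁻ x, ENNReal.ofReal (weakGradNormSq (G t) x) < ⊤)
    {φ : EuclideanSpace ℝ d → ℝ} (_hφ : FluidPDE.IsMollifier φ)
    {ψ : ℝ → UnitAddTorus d → ℝ} (_hψ : FunctionSpaces.Torus.IsSpaceTimeTestIoo T ψ),
    Tendsto (fun ε => ∫ t in Ioo 0 T, ∫ x,
        ⟪u t x, FunctionSpaces.Torus.laplacian (symmTestField (mollifierKernel φ ε) (ψ t) (u t)) x⟫)
      (𝓝[>] 0)
      (𝓝 ((∫ t in Ioo 0 T, ∫ x, ‖u t x‖ ^ 2 * FunctionSpaces.Torus.laplacian (ψ t) x) -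
        2 * ∫ t in Ioo 0 T, ∫ x, weakGradNormSq (G t) x * ψ t x))

end Facts

/-! ## Weak gradients of `L²_t H¹_x` fields (spectral construction) -/

section Gradient

open UnitAddTorus

variable {T : ℝ} {u : ℝ → UnitAddTorus d → EuclideanSpace ℝ d}

omit [DecidableEq d] in
/-- An `L²(0,T; H¹)` field (spectral class `Torus.MemL2Sobolev 0 T 1` of the complexified field)
has finite total spectral dissipation `∫₀ᵀ ‖∇u‖₂² < ∞` (`‖∇u‖₂² ≤ 4π² ‖u‖²_{H¹}`,
`Torus.eGradNormSq_le`; the hypothesis-minimal form of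
`Torus.IsLerayHopfOn.lintegral_eGradNormSq_lt_top`). [folklore] -/
theorem lintegral_eGradNormSq_lt_top_of_memL2Sobolev
    (h : FunctionSpaces.Torus.MemL2Sobolev 0 T 1 (fun t => FunctionSpaces.EuclideanSpace.complexify ∘ u t)) :
    ∫⁻ t in Ioo 0 T, FunctionSpaces.Torus.eGradNormSq (u t) < ⊤ := by
  have h2 := h.2
  unfold FunctionSpaces.Torus.eL2SobolevNorm at h2
  have h3 : ∫⁻ t in Ioo 0 T, FunctionSpaces.Torus.eSobolevNorm 1
      (FunctionSpaces.EuclideanSpace.complexify ∘ u t) ^ 2 < ⊤ := by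
    by_contra hc
    rw [not_lt, top_le_iff] at hc
    rw [hc, ENNReal.top_rpow_of_pos (by norm_num)] at h2
    exact lt_irrefl _ h2
  calc ∫⁻ t in Ioo 0 T, FunctionSpaces.Torus.eGradNormSq (u t)
      ≤ ∫⁻ t in Ioo 0 T, ENNReal.ofReal (4 * Real.pi ^ 2) *
          FunctionSpaces.Torus.eSobolevNorm 1 (FunctionSpaces.EuclideanSpace.complexify ∘ u t) ^ 2 :=
        lintegral_mono fun t => eGradNormSq_le (u t)
    _ = ENNReal.ofReal (4 * Real.pi ^ 2) * ∫⁻ t in Ioo 0 T,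
          FunctionSpaces.Torus.eSobolevNorm 1 (FunctionSpaces.EuclideanSpace.complexify ∘ u t) ^ 2 :=
        lintegral_const_mul' _ _ ENNReal.ofReal_ne_top
    _ < ⊤ := ENNReal.mul_lt_top ENNReal.ofReal_lt_top h3

/-- **Jointly measurable `L²` weak gradients of `L²(0,T; H¹)` fields** (Evans 2010, §5.9.2;
Robinson–Rodrigo–Sadowski 2016, §1.7.1: `H¹(𝕋³)` through Fourier series). The hypothesis-minimal
form of the accepted `Torus.IsLerayHopfOn.exists_hasWeakGradient_holds` (same proof: measurable
slice Fourier coefficients, the parametrised Riesz–Fischer theorem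
`Torus.exists_memLp_two_forall_mFourierCoeff_eq`, and the slice-wise identification
`Torus.hasWeakPartialDeriv_of_mFourierCoeff` with Parseval): a jointly measurable `u` on
`(0,T) × T^d` with `L²` slices and complexified field in `MemL2Sobolev 0 T 1` has a jointly
measurable field `G` with, for a.e. `t ∈ (0,T)`, `G t` an integrable weak gradient of `u t` and
`∫⁻ |G t|² = eGradNormSq (u t)`. [cite: Evans2010, §5.9.2] -/
theorem exists_hasWeakGradient_of_memL2Sobolev
    (hU : AEStronglyMeasurable (uncurry u) ((volume.restrict (Ioo 0 T)).prod volume))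
    (hLp : ∀ᵐ t ∂(volume.restrict (Ioo 0 T)), MemLp (u t) 2 volume)
    (hH1 : FunctionSpaces.Torus.MemL2Sobolev 0 T 1 (fun t => FunctionSpaces.EuclideanSpace.complexify ∘ u t)) :
    ∃ G : ℝ → UnitAddTorus d → EuclideanSpace ℝ d →L[ℝ] EuclideanSpace ℝ d,
      AEStronglyMeasurable (uncurry G) ((volume.restrict (Ioo 0 T)).prod volume) ∧
      ∀ᵐ t ∂(volume.restrict (Ioo 0 T)),
        HasWeakGradient (u t) (G t) ∧ Integrable (G t) volume ∧
          ∫⁻ x, ENNReal.ofReal (weakGradNormSq (G t) x) = FunctionSpaces.Torus.eGradNormSq (u t) := by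
  set μ : Measure ℝ := volume.restrict (Ioo 0 T) with hμ
  -- the candidate coefficients of `∂ⱼ uᵢ`
  set c : d → d → ℝ → (d → ℤ) → ℂ := fun i j t k =>
    (2 * Real.pi * Complex.I * (k j) : ℂ) * mFourierCoeff (fun x => (u t x i : ℂ)) k with hc_def
  have hc : ∀ i j k, AEStronglyMeasurable (fun t => c i j t k) μ := fun i j k =>
    aestronglyMeasurable_const.mul (aestronglyMeasurable_mFourierCoeff_slice hU i k)
  have hC : ∀ i j, ∫⁻ t, ∑' k, ‖c i j t k‖ₑ ^ 2 ∂μ ≠ ⊤ := by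
    intro i j
    refine ne_top_of_le_ne_top (lintegral_eGradNormSq_lt_top_of_memL2Sobolev hH1).ne ?_
    refine lintegral_mono_ae (hLp.mono fun t ht => ?_)
    exact tsum_enorm_sq_freq_mul_mFourierCoeff_le (ht.integrable one_le_two) i j
  -- Riesz–Fischer with the parameter `t`
  choose g hgm hg using fun i j => FunctionSpaces.Torus.exists_memLp_two_forall_mFourierCoeff_eq (hc i j) (hC i j)
  refine ⟨fun t x => ∑ i, ∑ j, (g i j t x).re •
    (EuclideanSpace.proj j : EuclideanSpace ℝ d →L[ℝ] ℝ).smulRight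
      (EuclideanSpace.single i (1 : ℝ)), ?_, ?_⟩
  · exact aestronglyMeasurable_sum_smul_smulRight fun i j =>
      Complex.continuous_re.comp_aestronglyMeasurable (hgm i j)
  · have hg' : ∀ᵐ t ∂μ, ∀ i j, MemLp (g i j t) 2 volume ∧
        ∀ k, mFourierCoeff (g i j t) k = c i j t k :=
      ae_all_iff.2 fun i => ae_all_iff.2 fun j => hg i j
    filter_upwards [hLp, hg'] with t hut hgt
    have hcoeff : ∀ i j (k : d → ℤ), mFourierCoeff (g i j t) k =
        (2 * Real.pi * Complex.I * (k j) : ℂ) * mFourierCoeff (fun x => (u t x i : ℂ)) k :=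
      fun i j k => (hgt i j).2 k
    refine ⟨fun j => ?_, ?_, ?_⟩
    · have hfun : (fun x => (∑ i, ∑ j', (g i j' t x).re •
          (EuclideanSpace.proj j' : EuclideanSpace ℝ d →L[ℝ] ℝ).smulRight
            (EuclideanSpace.single i (1 : ℝ))) (EuclideanSpace.single j (1 : ℝ))) =
          fun x => ∑ i, (g i j t x).re • EuclideanSpace.single i (1 : ℝ) :=
        funext fun x => sum_smul_smulRight_apply_single (fun i j' => (g i j' t x).re) j
      rw [hfun]
      exact FunctionSpaces.Torus.hasWeakPartialDeriv_of_mFourierCoeff hut (fun i => (hgt i j).1) j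
        (fun i k => hcoeff i j k)
    · exact integrable_sum_smul_smulRight fun i j =>
        (Complex.reCLM.comp_memLp' (hgt i j).1).integrable one_le_two
    · have hre : ∀ᵐ x ∂volume, ∀ i j, (g i j t x).re ^ 2 = ‖g i j t x‖ ^ 2 :=
        ae_all_iff.2 fun i => ae_all_iff.2 fun j =>
          FunctionSpaces.Torus.re_sq_ae_eq_norm_sq_of_mFourierCoeff (hut.eval_piLp i) (hgt i j).1 j (hcoeff i j)
      rw [← FunctionSpaces.Torus.lintegral_sum_enorm_sq_eq_eGradNormSq hut (fun i j => (hgt i j).1) hcoeff]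
      refine lintegral_congr_ae (hre.mono fun x hx => ?_)
      dsimp only
      rw [weakGradNormSq_eq_sum]
      simp_rw [sum_smul_smulRight_apply_single, norm_sq_sum_smul_single]
      rw [Finset.sum_comm, ENNReal.ofReal_sum_of_nonneg fun i _ =>
        Finset.sum_nonneg fun j _ => sq_nonneg _]
      refine Finset.sum_congr rfl fun i _ => ?_
      rw [ENNReal.ofReal_sum_of_nonneg fun j _ => sq_nonneg _]
      refine Finset.sum_congr rfl fun j _ => ?_
      rw [hx i j, ← ofReal_norm, ENNReal.ofReal_pow (norm_nonneg _)]

end Gradient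

/-! ## Glue for the assembly -/

section Glue2

variable {T : ℝ} {F' : Type*} [NormedAddCommGroup F']

omit [DecidableEq d] in
/-- From the guarded mixed class `L^r(0,T; L^r(T^d))` (`Torus.MemLqLp r r`) to the joint bound
`∫₀ᵀ∫ ‖f‖^r < ∞` (Fubini–Tonelli; converse of `Torus.memLqLp_of_lintegral_lt_top`). [folklore] -/
theorem lintegral_rpow_lt_top_of_memLqLp {r : ℝ≥0∞} (hr0 : r ≠ 0) (hrtop : r ≠ ⊤)
    {f : ℝ → UnitAddTorus d → F'} (hf : MemLqLp r r f (Ioo 0 T)) :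
    ∫⁻ t in Ioo 0 T, ∫⁻ x, ‖f t x‖ₑ ^ r.toReal < ⊤ := by
  have hr : 0 < r.toReal := ENNReal.toReal_pos hr0 hrtop
  have hkey : ∀ᵐ t ∂(volume.restrict (Ioo 0 T)),
      ∫⁻ x, ‖f t x‖ₑ ^ r.toReal = ‖(eLpNorm (f t) r volume).toReal‖ₑ ^ r.toReal := by
    filter_upwards [hf.1] with t ht
    rw [Real.enorm_eq_ofReal ENNReal.toReal_nonneg, ENNReal.ofReal_toReal ht.eLpNorm_ne_top,
      eLpNorm_eq_lintegral_rpow_enorm_toReal hr0 hrtop, ← ENNReal.rpow_mul,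
      one_div_mul_cancel hr.ne', ENNReal.rpow_one]
  rw [lintegral_congr_ae hkey]
  have h2 := hf.2
  change eLpNorm (fun t => (eLpNorm (f t) r volume).toReal) r (volume.restrict (Ioo 0 T)) < ⊤ at h2
  rwa [eLpNorm_lt_top_iff_lintegral_rpow_enorm_lt_top hr0 hrtop] at h2

omit [DecidableEq d] in
/-- `u ∈ L³(0,T; L³(T^d))` (guarded) gives `∫₀ᵀ∫ ‖u‖³ < ∞`. [folklore] -/
theorem lintegral_pow_three_lt_top_of_memLqLp {f : ℝ → UnitAddTorus d → F'}
    (hf : MemLqLp 3 3 f (Ioo 0 T)) : ∫⁻ t in Ioo 0 T, ∫⁻ x, ‖f t x‖ₑ ^ 3 < ⊤ := by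
  have h := lintegral_rpow_lt_top_of_memLqLp three_ne_zero ENNReal.ofNat_ne_top hf
  have h3 : ∀ x : ℝ≥0∞, x ^ (3 : ℝ≥0∞).toReal = x ^ (3 : ℕ) := fun x => by
    rw [ENNReal.toReal_ofNat, ← ENNReal.rpow_natCast]; norm_num
  simpa only [h3] using h

omit [DecidableEq d] in
/-- `p ∈ L^{3/2}(0,T; L^{3/2}(T^d))` (guarded) gives `∫₀ᵀ∫ ‖p‖^{3/2} < ∞`. [folklore] -/
theorem lintegral_rpow_threeHalves_lt_top_of_memLqLp {f : ℝ → UnitAddTorus d → F'}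
    (hf : MemLqLp (3 / 2) (3 / 2) f (Ioo 0 T)) :
    ∫⁻ t in Ioo 0 T, ∫⁻ x, ‖f t x‖ₑ ^ (3 / 2 : ℝ) < ⊤ := by
  have h := lintegral_rpow_lt_top_of_memLqLp (r := 3 / 2) (by norm_num)
    (ENNReal.div_ne_top ENNReal.ofNat_ne_top (by norm_num)) hf
  have h32 : ((3 / 2 : ℝ≥0∞)).toReal = (3 / 2 : ℝ) := by
    rw [ENNReal.toReal_div, ENNReal.toReal_ofNat, ENNReal.toReal_ofNat]
  simpa only [h32] using h

variable {v : ℝ → UnitAddTorus d → EuclideanSpace ℝ d} {q : ℝ → UnitAddTorus d → ℝ}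

omit [DecidableEq d] in
/-- **Integrability of the pieces of the local energy flux** on `(0,T) × T^d` for `v ∈ L³_{t,x}`,
`q ∈ L^{3/2}_{t,x}` (jointly measurable) against a bounded measurable weight `b` and a bounded
measurable vector weight `w`: `|v|² b`, `|v|² ⟪v, w⟫` and `q ⟪v, w⟫` are integrable
(Hölder `3/2, 3`). [folklore] -/
theorem integrable_flux_pieces
    (hv : AEStronglyMeasurable (uncurry v) ((volume.restrict (Ioo 0 T)).prod volume))
    (hv3 : ∫⁻ t in Ioo 0 T, ∫⁻ x, ‖v t x‖ₑ ^ 3 < ⊤)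
    (hq : AEStronglyMeasurable (uncurry q) ((volume.restrict (Ioo 0 T)).prod volume))
    (hq32 : ∫⁻ t in Ioo 0 T, ∫⁻ x, ‖q t x‖ₑ ^ (3 / 2 : ℝ) < ⊤)
    {b : ℝ → UnitAddTorus d → ℝ} {w : ℝ → UnitAddTorus d → EuclideanSpace ℝ d}
    (hbm : AEStronglyMeasurable (uncurry b) ((volume.restrict (Ioo 0 T)).prod volume))
    (hwm : AEStronglyMeasurable (uncurry w) ((volume.restrict (Ioo 0 T)).prod volume))
    {C : ℝ} (hb : ∀ t ∈ Icc 0 T, ∀ x, ‖b t x‖ ≤ C) (hw : ∀ t ∈ Icc 0 T, ∀ x, ‖w t x‖ ≤ C) :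
    Integrable (fun z : ℝ × UnitAddTorus d => ‖v z.1 z.2‖ ^ 2 * b z.1 z.2)
        ((volume.restrict (Ioo 0 T)).prod volume) ∧
      Integrable (fun z : ℝ × UnitAddTorus d => ‖v z.1 z.2‖ ^ 2 * ⟪v z.1 z.2, w z.1 z.2⟫)
        ((volume.restrict (Ioo 0 T)).prod volume) ∧
      Integrable (fun z : ℝ × UnitAddTorus d => q z.1 z.2 * ⟪v z.1 z.2, w z.1 z.2⟫)
        ((volume.restrict (Ioo 0 T)).prod volume) := by
  set μT := (volume.restrict (Ioo 0 T)).prod (volume : Measure (UnitAddTorus d)) with hμT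
  have e3 : ∫⁻ t in Ioo 0 T, ∫⁻ x, ‖v t x‖ₑ ^ (3 : ℕ) = ∫⁻ z, ‖v z.1 z.2‖ₑ ^ (3 : ℕ) ∂μT :=
    lintegral_Ioo_lintegral_eq_lintegral_prod (hv.enorm.pow_const _)
  have e32 : ∫⁻ t in Ioo 0 T, ∫⁻ x, ‖q t x‖ₑ ^ (3 / 2 : ℝ) = ∫⁻ z, ‖q z.1 z.2‖ₑ ^ (3 / 2 : ℝ) ∂μT :=
    lintegral_Ioo_lintegral_eq_lintegral_prod (hq.enorm.pow_const _)
  rw [e3] at hv3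
  rw [e32] at hq32
  have hM3 : MemLp (uncurry v) 3 μT := by
    refine ⟨hv, (eLpNorm_lt_top_iff_lintegral_rpow_enorm_lt_top three_ne_zero
      ENNReal.ofNat_ne_top).2 ?_⟩
    have h3 : ∀ x : ℝ≥0∞, x ^ (3 : ℝ≥0∞).toReal = x ^ (3 : ℕ) := fun x => by
      rw [ENNReal.toReal_ofNat, ← ENNReal.rpow_natCast]; norm_num
    simpa only [h3, Function.uncurry] using hv3
  have I2 : Integrable (fun z => ‖v z.1 z.2‖ ^ 2) μT :=
    (memLp_two_iff_integrable_sq_norm hv).1 (hM3.mono_exponent (by norm_num))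
  have I3 : Integrable (fun z => ‖v z.1 z.2‖ ^ 3) μT := by
    have h := hM3.integrable_norm_rpow three_ne_zero ENNReal.ofNat_ne_top
    refine h.congr (Eventually.of_forall fun z => ?_)
    simp only [ENNReal.toReal_ofNat, uncurry]
    norm_cast
  have Iqv : Integrable (fun z => ‖q z.1 z.2‖ * ‖v z.1 z.2‖) μT := by
    refine ⟨(hq.norm.mul hv.norm), ?_⟩
    have hH : Real.HolderConjugate (3 / 2 : ℝ) 3 := ⟨by norm_num, by norm_num, by norm_num⟩
    have h := ENNReal.lintegral_mul_le_Lp_mul_Lq μT hH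
      (f := fun z => ‖q z.1 z.2‖ₑ) (g := fun z => ‖v z.1 z.2‖ₑ) hq.enorm hv.enorm
    have h3 : ∀ x : ℝ≥0∞, x ^ (3 : ℝ) = x ^ (3 : ℕ) := fun x => by
      rw [← ENNReal.rpow_natCast]; norm_num
    simp only [Pi.mul_apply, h3] at h
    refine lt_of_le_of_lt (lintegral_mono fun z => ?_) (lt_of_le_of_lt h ?_)
    · rw [enorm_mul, enorm_norm, enorm_norm]
    · exact ENNReal.mul_lt_top (ENNReal.rpow_lt_top_of_nonneg (by norm_num) hq32.ne)
        (ENNReal.rpow_lt_top_of_nonneg (by norm_num) hv3.ne)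
  have hIoo : ∀ᵐ z ∂μT, z.1 ∈ Ioo 0 T := by
    rw [hμT, ← volume_restrict_Ioo_prod_univ]
    filter_upwards [ae_restrict_mem (measurableSet_Ioo.prod MeasurableSet.univ)] with z hz
    exact hz.1
  have hv2m : AEStronglyMeasurable (fun z : ℝ × UnitAddTorus d => ‖v z.1 z.2‖ ^ 2) μT :=
    (continuous_norm.pow 2).comp_aestronglyMeasurable hv
  have hin : AEStronglyMeasurable (fun z : ℝ × UnitAddTorus d => ⟪v z.1 z.2, w z.1 z.2⟫) μT :=
    hv.inner hwm
  refine ⟨?_, ?_, ?_⟩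
  · refine (I2.const_mul C).mono' (hv2m.mul hbm) ?_
    filter_upwards [hIoo] with z hz
    rw [norm_mul, norm_pow, norm_norm]
    calc ‖v z.1 z.2‖ ^ 2 * ‖b z.1 z.2‖ ≤ ‖v z.1 z.2‖ ^ 2 * C :=
          mul_le_mul_of_nonneg_left (hb z.1 (Ioo_subset_Icc_self hz) z.2) (sq_nonneg _)
      _ = C * ‖v z.1 z.2‖ ^ 2 := mul_comm _ _
  · refine (I3.const_mul C).mono' (hv2m.mul hin) ?_
    filter_upwards [hIoo] with z hz
    rw [norm_mul, norm_pow, norm_norm]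
    have hi : ‖⟪v z.1 z.2, w z.1 z.2⟫‖ ≤ ‖v z.1 z.2‖ * C :=
      (norm_inner_le_norm _ _).trans
        (mul_le_mul_of_nonneg_left (hw z.1 (Ioo_subset_Icc_self hz) z.2) (norm_nonneg _))
    calc ‖v z.1 z.2‖ ^ 2 * ‖⟪v z.1 z.2, w z.1 z.2⟫‖ ≤ ‖v z.1 z.2‖ ^ 2 * (‖v z.1 z.2‖ * C) :=
          mul_le_mul_of_nonneg_left hi (sq_nonneg _)
      _ = C * ‖v z.1 z.2‖ ^ 3 := by ring
  · refine (Iqv.const_mul C).mono' (hq.mul hin) ?_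
    filter_upwards [hIoo] with z hz
    rw [norm_mul]
    have hi : ‖⟪v z.1 z.2, w z.1 z.2⟫‖ ≤ ‖v z.1 z.2‖ * C :=
      (norm_inner_le_norm _ _).trans
        (mul_le_mul_of_nonneg_left (hw z.1 (Ioo_subset_Icc_self hz) z.2) (norm_nonneg _))
    calc ‖q z.1 z.2‖ * ‖⟪v z.1 z.2, w z.1 z.2⟫‖ ≤ ‖q z.1 z.2‖ * (‖v z.1 z.2‖ * C) :=
          mul_le_mul_of_nonneg_left hi (norm_nonneg _)
      _ = C * (‖q z.1 z.2‖ * ‖v z.1 z.2‖) := by ring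

end Glue2

/-! ## The assembly: Duchon–Robert's Prop. 1–2 from the printed steps -/

section Assembly

variable {T ν : ℝ} {u : ℝ → UnitAddTorus d → EuclideanSpace ℝ d} {p : ℝ → UnitAddTorus d → ℝ}

/-- **Duchon–Robert 2000, Prop. 1 (Navier–Stokes) and Prop. 2 (Euler), assembled from the printed
steps.** Granted the cubic identity (`integral_kernelFlux_mul_eq`), the tested momentum equation
(`IsDistributionalNSSolutionOn.symmTestField_identity`) and the three limit facts
(`tendsto_mollified_transport`, `tendsto_pressure_pairing`, `tendsto_viscous_pairing`), the named
fact `FluidPDE.duchon_robert_defect_exists` holds: for a distributional solution `(u, p)` with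
`u ∈ L³_{t,x}`, `p ∈ L^{3/2}_{t,x}` (and `u ∈ L²_t H¹_x` if `ν ≠ 0`), the Duchon–Robert fluxes
`∫₀ᵀ∫ D_ε(u) ψ` converge, for every mollifier `φ` and every test function `ψ` supported in
`(0,T)`, to the local energy flux
`D(u)(ψ) = ∫₀ᵀ∫ [½|u|²∂ₜψ + (½|u|² + p)⟪u,∇ψ⟫ + ½ν|u|²Δψ − ν|∇u|²ψ]`, which is taken as the
defect functional, so that the local energy balance `Torus.HasLocalEnergyBalance` holds by
construction (with the spectral weak gradient of `exists_hasWeakGradient_of_memL2Sobolev`, or `0`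
for `ν = 0`). Proof (Duchon–Robert 2000, proof of Prop. 1, pp. 250–251): for `ε > 0`,
`4∫₀ᵀ∫ D_ε(u)ψ = ∫₀ᵀ∫ 𝒟_{K_ε}(u)ψ` (`four_mul_duchonRobertApprox_eq_kernelFlux`, slice-wise)
`= A_ε − B_ε + 2E_ε − 2C_ε` (cubic identity) with `−C_ε = T_ε + νV_ε + P_ε` (tested equation);
the limits of `A_ε, B_ε, E_ε, T_ε, P_ε, V_ε` then give `4 D(u)(ψ)` (Fubini splits the flux). [cite: DuchonRobert2000, Prop. 1–2 pp. 250–251] -/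
theorem duchon_robert_defect_exists_of
    (hAlg : integral_kernelFlux_mul_eq (d := d))
    (hEq : IsDistributionalNSSolutionOn.symmTestField_identity (d := d))
    (hLimT : tendsto_mollified_transport (d := d))
    (hLimP : tendsto_pressure_pairing (d := d))
    (hLimV : tendsto_viscous_pairing (d := d)) :
    FluidPDE.duchon_robert_defect_exists (T := T) (ν := ν) (u := u) (p := p) := by
  intro hT hν hsol hu3 hp hH1
  set μT := (volume.restrict (Ioo 0 T)).prod (volume : Measure (UnitAddTorus d)) with hμT
  have hum : AEStronglyMeasurable (uncurry u) μT := aestronglyMeasurable_uncurry_prod hsol.1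
  have hpm : AEStronglyMeasurable (uncurry p) μT := aestronglyMeasurable_uncurry_prod hsol.2.2.1
  have hu3' : ∫⁻ t in Ioo 0 T, ∫⁻ x, ‖u t x‖ₑ ^ 3 < ⊤ := lintegral_pow_three_lt_top_of_memLqLp hu3
  have hp' : ∫⁻ t in Ioo 0 T, ∫⁻ x, ‖p t x‖ₑ ^ (3 / 2 : ℝ) < ⊤ :=
    lintegral_rpow_threeHalves_lt_top_of_memLqLp hp
  have hdiv : ∀ᵐ t ∂(volume.restrict (Ioo 0 T)), FunctionSpaces.Torus.IsWeaklyDivFree (u t) :=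
    hsol.2.2.2.2.1
  have hslice3 : ∀ᵐ t ∂(volume.restrict (Ioo 0 T)), MemLp (u t) 3 volume := hu3.1
  -- the weak gradient: zero in the inviscid case, the spectral one (with Parseval) otherwise
  obtain ⟨G, hGmeas, hGae, hG2, hG0⟩ : ∃ G : ℝ → UnitAddTorus d → EuclideanSpace ℝ d →L[ℝ] EuclideanSpace ℝ d,
      AEStronglyMeasurable (uncurry G) μT ∧
      (ν ≠ 0 → ∀ᵐ t ∂(volume.restrict (Ioo 0 T)),
        HasWeakGradient (u t) (G t) ∧ Integrable (G t) volume) ∧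
      (ν ≠ 0 → ∫⁻ t in Ioo 0 T, ∫⁻ x, ENNReal.ofReal (weakGradNormSq (G t) x) < ⊤) ∧
      (ν = 0 → G = 0) := by
    by_cases hν0 : ν = 0
    · refine ⟨0, ?_, fun h => (h hν0).elim, fun h => (h hν0).elim, fun _ => rfl⟩
      exact (aestronglyMeasurable_const (b := (0 : EuclideanSpace ℝ d →L[ℝ] EuclideanSpace ℝ d)))
    · have hL2 : ∀ᵐ t ∂(volume.restrict (Ioo 0 T)), MemLp (u t) 2 volume :=
        hslice3.mono fun t ht => ht.mono_exponent (by norm_num)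
      obtain ⟨G, hGm, hG⟩ := exists_hasWeakGradient_of_memL2Sobolev hum hL2 (hH1 hν0)
      refine ⟨G, hGm, fun _ => hG.mono fun t ht => ⟨ht.1, ht.2.1⟩, fun _ => ?_, fun h => (hν0 h).elim⟩
      calc ∫⁻ t in Ioo 0 T, ∫⁻ x, ENNReal.ofReal (weakGradNormSq (G t) x)
          = ∫⁻ t in Ioo 0 T, FunctionSpaces.Torus.eGradNormSq (u t) :=
            lintegral_congr_ae (hG.mono fun t ht => ht.2.2)
        _ < ⊤ := lintegral_eGradNormSq_lt_top_of_memL2Sobolev (hH1 hν0)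
  -- the defect functional: the local energy flux with this gradient
  refine ⟨fun ψ => ∫ t in Ioo 0 T, ∫ x,
      (2⁻¹ * ‖u t x‖ ^ 2 * FunctionSpaces.Torus.timeDeriv ψ t x +
        (2⁻¹ * ‖u t x‖ ^ 2 + p t x) * ⟪u t x, FunctionSpaces.Torus.gradient (ψ t) x⟫ +
        2⁻¹ * ν * ‖u t x‖ ^ 2 * FunctionSpaces.Torus.laplacian (ψ t) x -
        ν * weakGradNormSq (G t) x * ψ t x), ?_, G, hGae,
    ⟨fun h => (hGae h).mono fun t ht => ht.1, fun ψ _ => rfl⟩⟩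
  -- `∫∫ D_ε(u) ψ → D(u)(ψ)`
  intro φ hφ ψ hψ
  -- Step 1: the identity at fixed `ε > 0`
  have key : ∀ ε, 0 < ε →
      (∫ t in Ioo 0 T, ∫ x, duchonRobertApprox φ ε (u t) x * ψ t x) =
        4⁻¹ * (((∫ t in Ioo 0 T, ∫ x,
            ⟪vecConv (fun y => ‖u t y‖ ^ 2 • u t y) (mollifierKernel φ ε) x,
              FunctionSpaces.Torus.gradient (ψ t) x⟫) -
          (∫ t in Ioo 0 T, ∫ x,
            ((fun y => ‖u t y‖ ^ 2) ⋆ mollifierKernel φ ε) x *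
              ⟪u t x, FunctionSpaces.Torus.gradient (ψ t) x⟫) +
          2 * (∫ t in Ioo 0 T, ∫ x,
            ⟪u t x, vecConv (u t) (mollifierKernel φ ε) x⟫ *
              ⟪u t x, FunctionSpaces.Torus.gradient (ψ t) x⟫)) +
          2 * (((∫ t in Ioo 0 T, ∫ x,
            ⟪u t x, vecConv (u t) (mollifierKernel φ ε) x⟫ * FunctionSpaces.Torus.timeDeriv ψ t x) +
            ν * (∫ t in Ioo 0 T, ∫ x, ⟪u t x, FunctionSpaces.Torus.laplacian
              (symmTestField (mollifierKernel φ ε) (ψ t) (u t)) x⟫)) +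
            (∫ t in Ioo 0 T, ∫ x, p t x * FunctionSpaces.Torus.divergence
              (symmTestField (mollifierKernel φ ε) (ψ t) (u t)) x))) := by
    intro ε hε
    have hK := isSmooth_mollifierKernel hφ hε
    have hKev := mollifierKernel_neg hφ ε
    have h2 := hAlg hsol.1 hu3' hdiv hK hKev hψ
    have h3 := hEq hsol hu3' hp' hK hKev hψ
    -- unfold `D_ε` slice-wise onto the torus
    have h1 : (∫ t in Ioo 0 T, ∫ x, duchonRobertApprox φ ε (u t) x * ψ t x) =
        4⁻¹ * ∫ t in Ioo 0 T, ∫ x, kernelFlux (mollifierKernel φ ε) (u t) x * ψ t x := by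
      rw [← integral_const_mul]
      refine integral_congr_ae (hslice3.mono fun t ht => ?_)
      dsimp only
      rw [← integral_const_mul]
      refine integral_congr_ae (ae_of_all _ fun x => ?_)
      dsimp only
      rw [← four_mul_duchonRobertApprox_eq_kernelFlux hφ hε ht x]
      ring
    rw [h1, h2]
    linear_combination (-(2:ℝ) * 4⁻¹) * h3
  -- Step 2: the limits of the six terms
  obtain ⟨hA, hB, hE, hTm⟩ := hLimT hsol.1 hu3' hφ hψ
  have hP := hLimP hsol.1 hu3' hdiv hsol.2.2.1 hp' hφ hψ
  have hV : Tendsto (fun ε => ν * ∫ t in Ioo 0 T, ∫ x, ⟪u t x, FunctionSpaces.Torus.laplacian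
      (symmTestField (mollifierKernel φ ε) (ψ t) (u t)) x⟫) (𝓝[>] 0)
      (𝓝 (ν * ((∫ t in Ioo 0 T, ∫ x, ‖u t x‖ ^ 2 * FunctionSpaces.Torus.laplacian (ψ t) x) -
        2 * ∫ t in Ioo 0 T, ∫ x, weakGradNormSq (G t) x * ψ t x))) := by
    by_cases hν0 : ν = 0
    · simp only [hν0, zero_mul]
      exact tendsto_const_nhds
    · exact (hLimV hsol.1 hu3' hGmeas (hGae hν0) (hG2 hν0) hφ hψ).const_mul ν
  have hlim := ((((hA.sub hB).add (hE.const_mul 2)).add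
    (((hTm.add hV).add hP).const_mul 2)).const_mul (4⁻¹ : ℝ))
  -- Step 3: the limit is `D(u)(ψ)` (Fubini splitting of the flux); integrability of the pieces
  obtain ⟨hψs, hdt, hgr, hla⟩ := hψ.isSpaceTimeTest.isSmoothSpaceTimeOn_derived
  obtain ⟨⟨Cdt, -, hCdt⟩, hdtm⟩ := hdt.bound_and_measurable T
  obtain ⟨⟨Cgr, -, hCgr⟩, hgrm⟩ := hgr.bound_and_measurable T
  obtain ⟨⟨Cla, -, hCla⟩, hlam⟩ := hla.bound_and_measurable T
  have hψm : AEStronglyMeasurable (uncurry ψ) μT := (hψs.bound_and_measurable T).2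
  obtain ⟨Cψ, hCψ⟩ := hψ.exists_abs_le
  obtain ⟨IT, IA, IP⟩ := integrable_flux_pieces hum hu3' hpm hp' hdtm hgrm (C := max Cdt Cgr)
    (fun t ht x => (hCdt t ht x).trans (le_max_left _ _))
    (fun t ht x => (hCgr t ht x).trans (le_max_right _ _))
  obtain ⟨IL, -, -⟩ := integrable_flux_pieces hum hu3' hpm hp' hlam hgrm (C := max Cla Cgr)
    (fun t ht x => (hCla t ht x).trans (le_max_left _ _))
    (fun t ht x => (hCgr t ht x).trans (le_max_right _ _))
  have IG : Integrable (fun z : ℝ × UnitAddTorus d => weakGradNormSq (G z.1) z.2 * ψ z.1 z.2) μT := by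
    by_cases hν0 : ν = 0
    · have h0 : (fun z : ℝ × UnitAddTorus d => weakGradNormSq (G z.1) z.2 * ψ z.1 z.2) = 0 := by
        funext z
        rw [hG0 hν0, weakGradNormSq_eq_frobeniusNormSq]
        simp [FluidPDE.frobeniusNormSq_zero]
      rw [h0]
      exact integrable_zero _ _ _
    · have hw : AEMeasurable (fun z : ℝ × UnitAddTorus d => weakGradNormSq (G z.1) z.2) μT :=
        aemeasurable_weakGradNormSq_uncurry hGmeas
      have Iw : Integrable (fun z : ℝ × UnitAddTorus d => weakGradNormSq (G z.1) z.2) μT := by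
        refine ⟨hw.aestronglyMeasurable, ?_⟩
        have h := hG2 hν0
        rw [lintegral_Ioo_lintegral_eq_lintegral_prod hw.ennreal_ofReal] at h
        refine lt_of_le_of_lt (lintegral_mono fun z => le_of_eq ?_) h
        exact (Real.enorm_eq_ofReal (weakGradNormSq_nonneg _ _))
      exact Iw.mul_bdd hψm (Eventually.of_forall fun z => by
        simpa [Real.norm_eq_abs] using hCψ z.1 z.2)
  -- the iterated integrals as product integrals
  have eT : (∫ t in Ioo 0 T, ∫ x, ‖u t x‖ ^ 2 * FunctionSpaces.Torus.timeDeriv ψ t x) =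
      ∫ z, ‖u z.1 z.2‖ ^ 2 * FunctionSpaces.Torus.timeDeriv ψ z.1 z.2 ∂μT := (integral_prod _ IT).symm
  have eA : (∫ t in Ioo 0 T, ∫ x, ‖u t x‖ ^ 2 * ⟪u t x, FunctionSpaces.Torus.gradient (ψ t) x⟫) =
      ∫ z, ‖u z.1 z.2‖ ^ 2 * ⟪u z.1 z.2, FunctionSpaces.Torus.gradient (ψ z.1) z.2⟫ ∂μT :=
    (integral_prod _ IA).symm
  have eP : (∫ t in Ioo 0 T, ∫ x, p t x * ⟪u t x, FunctionSpaces.Torus.gradient (ψ t) x⟫) =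
      ∫ z, p z.1 z.2 * ⟪u z.1 z.2, FunctionSpaces.Torus.gradient (ψ z.1) z.2⟫ ∂μT :=
    (integral_prod _ IP).symm
  have eL : (∫ t in Ioo 0 T, ∫ x, ‖u t x‖ ^ 2 * FunctionSpaces.Torus.laplacian (ψ t) x) =
      ∫ z, ‖u z.1 z.2‖ ^ 2 * FunctionSpaces.Torus.laplacian (ψ z.1) z.2 ∂μT :=
    (integral_prod _ IL).symm
  have eG : (∫ t in Ioo 0 T, ∫ x, weakGradNormSq (G t) x * ψ t x) =
      ∫ z, weakGradNormSq (G z.1) z.2 * ψ z.1 z.2 ∂μT := (integral_prod _ IG).symm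
  -- the flux integrand and its splitting
  have Icomb : Integrable (fun z : ℝ × UnitAddTorus d =>
      2⁻¹ * ‖u z.1 z.2‖ ^ 2 * FunctionSpaces.Torus.timeDeriv ψ z.1 z.2 +
        (2⁻¹ * ‖u z.1 z.2‖ ^ 2 + p z.1 z.2) * ⟪u z.1 z.2, FunctionSpaces.Torus.gradient (ψ z.1) z.2⟫ +
        2⁻¹ * ν * ‖u z.1 z.2‖ ^ 2 * FunctionSpaces.Torus.laplacian (ψ z.1) z.2 -
        ν * weakGradNormSq (G z.1) z.2 * ψ z.1 z.2) μT := by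
    refine ((((IT.const_mul 2⁻¹).add ((IA.const_mul 2⁻¹).add IP)).add
      (IL.const_mul (2⁻¹ * ν))).sub (IG.const_mul ν)).congr (ae_of_all _ fun z => ?_)
    simp only [Pi.add_apply, Pi.sub_apply]
    ring
  have eD : (∫ t in Ioo 0 T, ∫ x,
      (2⁻¹ * ‖u t x‖ ^ 2 * FunctionSpaces.Torus.timeDeriv ψ t x +
        (2⁻¹ * ‖u t x‖ ^ 2 + p t x) * ⟪u t x, FunctionSpaces.Torus.gradient (ψ t) x⟫ +
        2⁻¹ * ν * ‖u t x‖ ^ 2 * FunctionSpaces.Torus.laplacian (ψ t) x -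
        ν * weakGradNormSq (G t) x * ψ t x)) =
      2⁻¹ * (∫ z, ‖u z.1 z.2‖ ^ 2 * FunctionSpaces.Torus.timeDeriv ψ z.1 z.2 ∂μT) +
        (2⁻¹ * (∫ z, ‖u z.1 z.2‖ ^ 2 * ⟪u z.1 z.2, FunctionSpaces.Torus.gradient (ψ z.1) z.2⟫ ∂μT) +
          ∫ z, p z.1 z.2 * ⟪u z.1 z.2, FunctionSpaces.Torus.gradient (ψ z.1) z.2⟫ ∂μT) +
        2⁻¹ * ν * (∫ z, ‖u z.1 z.2‖ ^ 2 * FunctionSpaces.Torus.laplacian (ψ z.1) z.2 ∂μT) -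
        ν * ∫ z, weakGradNormSq (G z.1) z.2 * ψ z.1 z.2 ∂μT := by
    rw [show (∫ t in Ioo 0 T, ∫ x,
      (2⁻¹ * ‖u t x‖ ^ 2 * FunctionSpaces.Torus.timeDeriv ψ t x +
        (2⁻¹ * ‖u t x‖ ^ 2 + p t x) * ⟪u t x, FunctionSpaces.Torus.gradient (ψ t) x⟫ +
        2⁻¹ * ν * ‖u t x‖ ^ 2 * FunctionSpaces.Torus.laplacian (ψ t) x -
        ν * weakGradNormSq (G t) x * ψ t x)) = ∫ z, (2⁻¹ * ‖u z.1 z.2‖ ^ 2 * FunctionSpaces.Torus.timeDeriv ψ z.1 z.2 +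
        (2⁻¹ * ‖u z.1 z.2‖ ^ 2 + p z.1 z.2) * ⟪u z.1 z.2, FunctionSpaces.Torus.gradient (ψ z.1) z.2⟫ +
        2⁻¹ * ν * ‖u z.1 z.2‖ ^ 2 * FunctionSpaces.Torus.laplacian (ψ z.1) z.2 -
        ν * weakGradNormSq (G z.1) z.2 * ψ z.1 z.2) ∂μT from (integral_prod _ Icomb).symm]
    -- integrability of the partial sums, in lambda form
    have J1 : Integrable (fun z : ℝ × UnitAddTorus d =>
        2⁻¹ * (‖u z.1 z.2‖ ^ 2 * FunctionSpaces.Torus.timeDeriv ψ z.1 z.2)) μT := IT.const_mul _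
    have J2 : Integrable (fun z : ℝ × UnitAddTorus d =>
        2⁻¹ * (‖u z.1 z.2‖ ^ 2 * ⟪u z.1 z.2, FunctionSpaces.Torus.gradient (ψ z.1) z.2⟫) +
          p z.1 z.2 * ⟪u z.1 z.2, FunctionSpaces.Torus.gradient (ψ z.1) z.2⟫) μT :=
      (IA.const_mul _).add IP
    have J3 : Integrable (fun z : ℝ × UnitAddTorus d =>
        2⁻¹ * ν * (‖u z.1 z.2‖ ^ 2 * FunctionSpaces.Torus.laplacian (ψ z.1) z.2)) μT := IL.const_mul _
    have J4 : Integrable (fun z : ℝ × UnitAddTorus d =>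
        ν * (weakGradNormSq (G z.1) z.2 * ψ z.1 z.2)) μT := IG.const_mul _
    have J12 : Integrable (fun z : ℝ × UnitAddTorus d =>
        2⁻¹ * (‖u z.1 z.2‖ ^ 2 * FunctionSpaces.Torus.timeDeriv ψ z.1 z.2) +
          (2⁻¹ * (‖u z.1 z.2‖ ^ 2 * ⟪u z.1 z.2, FunctionSpaces.Torus.gradient (ψ z.1) z.2⟫) +
            p z.1 z.2 * ⟪u z.1 z.2, FunctionSpaces.Torus.gradient (ψ z.1) z.2⟫)) μT := J1.add J2
    have J123 : Integrable (fun z : ℝ × UnitAddTorus d =>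
        2⁻¹ * (‖u z.1 z.2‖ ^ 2 * FunctionSpaces.Torus.timeDeriv ψ z.1 z.2) +
          (2⁻¹ * (‖u z.1 z.2‖ ^ 2 * ⟪u z.1 z.2, FunctionSpaces.Torus.gradient (ψ z.1) z.2⟫) +
            p z.1 z.2 * ⟪u z.1 z.2, FunctionSpaces.Torus.gradient (ψ z.1) z.2⟫) +
          2⁻¹ * ν * (‖u z.1 z.2‖ ^ 2 * FunctionSpaces.Torus.laplacian (ψ z.1) z.2)) μT := J12.add J3
    have hpt : ∀ z : ℝ × UnitAddTorus d,
        2⁻¹ * ‖u z.1 z.2‖ ^ 2 * FunctionSpaces.Torus.timeDeriv ψ z.1 z.2 +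
          (2⁻¹ * ‖u z.1 z.2‖ ^ 2 + p z.1 z.2) * ⟪u z.1 z.2, FunctionSpaces.Torus.gradient (ψ z.1) z.2⟫ +
          2⁻¹ * ν * ‖u z.1 z.2‖ ^ 2 * FunctionSpaces.Torus.laplacian (ψ z.1) z.2 -
          ν * weakGradNormSq (G z.1) z.2 * ψ z.1 z.2 =
        2⁻¹ * (‖u z.1 z.2‖ ^ 2 * FunctionSpaces.Torus.timeDeriv ψ z.1 z.2) +
          (2⁻¹ * (‖u z.1 z.2‖ ^ 2 * ⟪u z.1 z.2, FunctionSpaces.Torus.gradient (ψ z.1) z.2⟫) +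
            p z.1 z.2 * ⟪u z.1 z.2, FunctionSpaces.Torus.gradient (ψ z.1) z.2⟫) +
          2⁻¹ * ν * (‖u z.1 z.2‖ ^ 2 * FunctionSpaces.Torus.laplacian (ψ z.1) z.2) -
          ν * (weakGradNormSq (G z.1) z.2 * ψ z.1 z.2) := fun z => by ring
    simp_rw [hpt]
    rw [integral_sub J123 J4, integral_add J12 J3, integral_add J1 J2, integral_add (IA.const_mul _) IP,
      integral_const_mul, integral_const_mul, integral_const_mul, integral_const_mul]
  -- conclusion
  have hcongr : (fun ε : ℝ => 4⁻¹ * (((∫ t in Ioo 0 T, ∫ x,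
            ⟪vecConv (fun y => ‖u t y‖ ^ 2 • u t y) (mollifierKernel φ ε) x,
              FunctionSpaces.Torus.gradient (ψ t) x⟫) -
          (∫ t in Ioo 0 T, ∫ x,
            ((fun y => ‖u t y‖ ^ 2) ⋆ mollifierKernel φ ε) x *
              ⟪u t x, FunctionSpaces.Torus.gradient (ψ t) x⟫) +
          2 * (∫ t in Ioo 0 T, ∫ x,
            ⟪u t x, vecConv (u t) (mollifierKernel φ ε) x⟫ *
              ⟪u t x, FunctionSpaces.Torus.gradient (ψ t) x⟫)) +
          2 * (((∫ t in Ioo 0 T, ∫ x,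
            ⟪u t x, vecConv (u t) (mollifierKernel φ ε) x⟫ * FunctionSpaces.Torus.timeDeriv ψ t x) +
            ν * (∫ t in Ioo 0 T, ∫ x, ⟪u t x, FunctionSpaces.Torus.laplacian
              (symmTestField (mollifierKernel φ ε) (ψ t) (u t)) x⟫)) +
            (∫ t in Ioo 0 T, ∫ x, p t x * FunctionSpaces.Torus.divergence
              (symmTestField (mollifierKernel φ ε) (ψ t) (u t)) x)))) =ᶠ[𝓝[>] 0]
      fun ε => ∫ t in Ioo 0 T, ∫ x, duchonRobertApprox φ ε (u t) x * ψ t x := by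
    filter_upwards [self_mem_nhdsWithin] with ε hε
    exact (key ε hε).symm
  have hval : (∫ t in Ioo 0 T, ∫ x,
      (2⁻¹ * ‖u t x‖ ^ 2 * FunctionSpaces.Torus.timeDeriv ψ t x +
        (2⁻¹ * ‖u t x‖ ^ 2 + p t x) * ⟪u t x, FunctionSpaces.Torus.gradient (ψ t) x⟫ +
        2⁻¹ * ν * ‖u t x‖ ^ 2 * FunctionSpaces.Torus.laplacian (ψ t) x -
        ν * weakGradNormSq (G t) x * ψ t x)) =
      4⁻¹ * ((((∫ t in Ioo 0 T, ∫ x, ‖u t x‖ ^ 2 * ⟪u t x, FunctionSpaces.Torus.gradient (ψ t) x⟫) -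
          ∫ t in Ioo 0 T, ∫ x, ‖u t x‖ ^ 2 * ⟪u t x, FunctionSpaces.Torus.gradient (ψ t) x⟫) +
          2 * ∫ t in Ioo 0 T, ∫ x, ‖u t x‖ ^ 2 * ⟪u t x, FunctionSpaces.Torus.gradient (ψ t) x⟫) +
        2 * ((∫ t in Ioo 0 T, ∫ x, ‖u t x‖ ^ 2 * FunctionSpaces.Torus.timeDeriv ψ t x) +
          ν * ((∫ t in Ioo 0 T, ∫ x, ‖u t x‖ ^ 2 * FunctionSpaces.Torus.laplacian (ψ t) x) -
            2 * ∫ t in Ioo 0 T, ∫ x, weakGradNormSq (G t) x * ψ t x) +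
          2 * ∫ t in Ioo 0 T, ∫ x, p t x * ⟪u t x, FunctionSpaces.Torus.gradient (ψ t) x⟫)) := by
    rw [eD, eT, eA, eP, eL, eG]
    ring
  show Tendsto (fun ε => ∫ t in Ioo 0 T, ∫ x, duchonRobertApprox φ ε (u t) x * ψ t x) (𝓝[>] 0)
    (𝓝 (∫ t in Ioo 0 T, ∫ x,
      (2⁻¹ * ‖u t x‖ ^ 2 * FunctionSpaces.Torus.timeDeriv ψ t x +
        (2⁻¹ * ‖u t x‖ ^ 2 + p t x) * ⟪u t x, FunctionSpaces.Torus.gradient (ψ t) x⟫ +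
        2⁻¹ * ν * ‖u t x‖ ^ 2 * FunctionSpaces.Torus.laplacian (ψ t) x -
        ν * weakGradNormSq (G t) x * ψ t x)))
  rw [hval]
  exact hlim.congr' hcongr

end Assembly

/-! ## The target fact, reduced to the printed steps and the pressure estimate -/

section Target

variable {T : ℝ} {u : ℝ → UnitAddTorus d → EuclideanSpace ℝ d}

omit [DecidableEq d] in
/-- **`Torus.IsDissipationMeasureOf.hasDuchonRobertDefect` from its printed ingredients.** The
accepted reduction `IsDissipationMeasureOf.hasDuchonRobertDefect_of` (Duchon–Robert 2000, proof
of Prop. 4, p. 253) consumes the pressure fact (A1) `exists_pressure_of_tendsto_L3`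
(Calderón–Zygmund on `T^d`), Duchon–Robert's Prop. 1–2 (P2) `FluidPDE.duchon_robert_defect_exists`
and (U) uniqueness of weak gradients — the last now proved (`HasWeakGradient.unique_holds`) and
the second assembled above (`duchon_robert_defect_exists_of`) — so the target fact follows from
(A1) and the five step facts of this file. [cite: DuchonRobert2000, Prop. 4 and its proof p. 253] -/
theorem IsDissipationMeasureOf.hasDuchonRobertDefect_of_steps
    (hA1 : exists_pressure_of_tendsto_L3 (T := T) (u := u))
    (hAlg : ∀ [DecidableEq d], integral_kernelFlux_mul_eq (d := d))
    (hEq : ∀ [DecidableEq d], IsDistributionalNSSolutionOn.symmTestField_identity (d := d))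
    (hLimT : ∀ [DecidableEq d], tendsto_mollified_transport (d := d))
    (hLimP : ∀ [DecidableEq d], tendsto_pressure_pairing (d := d))
    (hLimV : ∀ [DecidableEq d], tendsto_viscous_pairing (d := d)) :
    IsDissipationMeasureOf.hasDuchonRobertDefect (T := T) (u := u) :=
  IsDissipationMeasureOf.hasDuchonRobertDefect_of hA1
    (fun {_} {_} {_} {_} => duchon_robert_defect_exists_of hAlg hEq hLimT hLimP hLimV)
    HasWeakGradient.unique_holds

end Target

end Literature.Analysis.FluidPDE.Torus
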